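import Summits.PneNP.PneNP.Theorems.ChebyshevTracialDesignGiantComponent
import HarnessLib

/-!
# Cell pnp-psdrank, route `ChebyshevTracialDesign`: the GENERAL SATURATED REDUCTION — a dense tight psd cell whose active tight pairs are
# rank-saturated is, up to trace-marginal junk, a tight psd rectangle of STRICTLY SMALLER dimension (crux `TracialDecayExp20`, stmt-PneNP-19878)

Brick 83 (prover g15; MEMO-16 §3(c), queued by prover g13/g14 as "the general saturated reduction / induction on dimension for the saturated
world"). Tightness of a psd pair gives `rank X_U + rank Y_M ≤ r` on every tight pair (brick 40). Call an active tight pair (`cc(U,M) = 1`,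
`X_U ≠ 0`, `Y_M ≠ 0`) SATURATED when `rank X_U + rank Y_M = r`. Then (§1, `range_eq_ker_of_saturated`) `range X_U = ker Y_M` EXACTLY — tightness
is LABEL EQUALITY for the labelling `κ U = range X_U`, `λ M = ker Y_M` by subspaces of `ℝ^r`, with no rank-one structure needed (brick 73 was the
rank-one cut side, brick 61 the case `r = 2`). Hence the giant-class lemma (brick 72, `value_le_giant_class_add`) applies: under the
(SNT-q)-existence hypothesis for the trace weight `tr Y/r` (bricks 59/61/72's shape; a theorem mod KL for homogeneous-dense weights, brick 65,
unconditional since brick 81b) and cut trace mass `≥ 3ε·r·#t-cuts`, ONE subspace `V* ≤ ℝ^r` carries all but `2ε r·#t-cuts` of the cut trace mass,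
and `V* ≠ ℝ^r` (a cut of full-rank `X_U` has no active tight partner, so the class of `⊤` is `ε`-light by (SNT-q)). Compressing by an isometry
`E : ℝ^k → V*` (`k = dim V* < r`; §1 `exists_isometry_of_submodule`, an orthonormal basis of `V*`) gives the `k`-dimensional pair
`X'_U = Eᵀ X_U E` (on the class), `Y'_M = Eᵀ Y_M E`, which is again a tight-orthogonal psd rectangle (`X_U E Eᵀ = X_U` on the class, so
`X'_U Y'_M = Eᵀ X_U Y_M E = 0` on EVERY tight pair) with the SAME kernel `tr(X'_U Y'_M) = tr(X_U Y_M)` there (§2). So: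

* **`saturated_reduction`** — the value of a saturated dense tight psd cell of dimension `r` is at most the value of an explicit tight-orthogonal
  psd rectangle of some dimension `k < r` plus `2·B_v·ε·r`;
* **`saturated_value_le`** — consequently, if `TracialValueLEAt W γ_k k` for every `k < r`, the cell has value `≤ k·γ_k + 2·B_v·ε·r` for some `k < r`:
  fully saturated dense cells REDUCE TO LOWER DIMENSION (an induction on dimension in the saturated world; with the `r = 1` rung this recovers
  bricks 61/73, and with the unconditional bounded-dimension theorem it bounds every saturated cell at fixed `r`).
Reading (MEMO-16 §3(d), MEMO-17 §3(e)): the residual of the dense cell at every `r` is UNSATURATION (`rank X_U + rank Y_M < r` on active tight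
pairs, where labels rotate along tight paths); saturation/rank hypotheses charge dimension and are not reset by the nowhere-zero padding of
brick 80b. [cite: Rothvoss2017, §2 (PDF p. 6)] [cite: BrietDadushPokutta2014, Thm. 6 (§3)] [cite: KupavskiiZakharov2022, §2]
Stature: support/instrument (linear algebra + bookkeeping; the (SNT-q) input is a hypothesis). WHAT THIS IS NOT: no bound on unsaturated cells,
nothing on psd rank of P_PM(K_n), no P-vs-NP content.
-/

set_option linter.dupNamespace false -- `Summit.PneNP.PneNP.…`: summit = sub-problem (D-0017)

noncomputable section

namespace Summit.PneNP.PneNP.Theorems.ChebyshevTracialDesignSaturatedReduction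

open Finset Matrix Literature.Barriers.PneNP Literature.Combinatorics.Optimization
open Summit.PneNP.PneNP.Theorems.ChebyshevTracialDesignGiantComponent

variable {n r : ℕ}

/-! ### §1 Linear algebra: saturation is label equality; isometries onto a subspace; compression -/

/-- `X Y = 0` for symmetric `X, Y` gives `range X ≤ ker Y` (`Y X = (X Y)ᵀ = 0`). -/
theorem range_le_ker_of_mul_eq_zero {X Y : Matrix (Fin r) (Fin r) ℝ} (hX : X.IsHermitian) (hY : Y.IsHermitian) (h : X * Y = 0) :
    LinearMap.range X.mulVecLin ≤ LinearMap.ker Y.mulVecLin := by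
  rintro _ ⟨v, rfl⟩
  rw [LinearMap.mem_ker, Matrix.mulVecLin_apply, Matrix.mulVecLin_apply, mulVec_mulVec]
  have hYX : Y * X = 0 := by
    have h' := congrArg Matrix.conjTranspose h
    rw [conjTranspose_mul, hX.eq, hY.eq, conjTranspose_zero] at h'
    exact h'
  rw [hYX, zero_mulVec]

/-- **SATURATION IS LABEL EQUALITY.** For symmetric `X, Y` of size `r` with `X Y = 0` and `rank X + rank Y = r`: `range X = ker Y`
(`range X ≤ ker Y` and `dim ker Y = r − rank Y = rank X`, rank–nullity). [cite: BrietDadushPokutta2014, Thm. 6 (§3)] -/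
theorem range_eq_ker_of_saturated {X Y : Matrix (Fin r) (Fin r) ℝ} (hX : X.IsHermitian) (hY : Y.IsHermitian) (h : X * Y = 0)
    (hrank : X.rank + Y.rank = r) : LinearMap.range X.mulVecLin = LinearMap.ker Y.mulVecLin := by
  refine Submodule.eq_of_le_of_finrank_eq (range_le_ker_of_mul_eq_zero hX hY h) ?_
  have hrn := LinearMap.finrank_range_add_finrank_ker Y.mulVecLin
  rw [Module.finrank_fin_fun] at hrn
  unfold Matrix.rank at hrank
  omega

/-- **Isometry onto a subspace.** Every subspace `V ≤ ℝ^r` is the range of an isometry `E : ℝ^k → ℝ^r`, `k = dim V`: `Eᵀ E = I_k` and `E Eᵀ`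
fixes `V` pointwise (the columns of `E` are an orthonormal basis of `V` for the dot product). -/
theorem exists_isometry_of_submodule (V : Submodule ℝ (Fin r → ℝ)) :
    ∃ E : Matrix (Fin r) (Fin (Module.finrank ℝ V)) ℝ, Eᴴ * E = 1 ∧ ∀ v ∈ V, (E * Eᴴ) *ᵥ v = v := by
  classical
  -- transport `V` to Euclidean space and take an orthonormal basis
  set L : (Fin r → ℝ) ≃ₗ[ℝ] EuclideanSpace ℝ (Fin r) := (WithLp.linearEquiv 2 ℝ (Fin r → ℝ)).symm with hL
  set V' : Submodule ℝ (EuclideanSpace ℝ (Fin r)) := V.map (L : (Fin r → ℝ) →ₗ[ℝ] EuclideanSpace ℝ (Fin r)) with hV'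
  have hfin : Module.finrank ℝ V' = Module.finrank ℝ V := LinearEquiv.finrank_map_eq L V
  set b : OrthonormalBasis (Fin (Module.finrank ℝ V')) ℝ V' := stdOrthonormalBasis ℝ V' with hb
  -- columns of `E` = the basis vectors
  set E : Matrix (Fin r) (Fin (Module.finrank ℝ V)) ℝ :=
    fun i j => (WithLp.ofLp ((b (Fin.cast hfin.symm j) : V') : EuclideanSpace ℝ (Fin r))) i with hE
  have hcol : ∀ j j', (∑ i, E i j * E i j') = if j = j' then 1 else 0 := by
    intro j j'
    have hon := (orthonormal_iff_ite.1 b.orthonormal) (Fin.cast hfin.symm j) (Fin.cast hfin.symm j')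
    rw [Submodule.coe_inner, EuclideanSpace.inner_eq_star_dotProduct, star_trivial] at hon
    have hjj : (Fin.cast hfin.symm j = Fin.cast hfin.symm j') ↔ j = j' := by
      constructor
      · intro h; exact Fin.cast_injective _ h
      · intro h; rw [h]
    simp only [hjj] at hon
    rw [← hon, dotProduct]
    exact Finset.sum_congr rfl fun i _ => by rw [hE]; ring
  refine ⟨E, ?_, fun v hv => ?_⟩
  · ext j j'
    rw [mul_apply, one_apply]
    simp only [conjTranspose_apply, star_trivial]
    exact hcol j j'
  · -- `E Eᵀ v = Σ_j ⟨b_j, v⟩ b_j = v`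
    set x : V' := ⟨L v, Submodule.mem_map_of_mem hv⟩ with hx
    have hsum := b.sum_repr' x
    have hsum' : ∑ j, (inner ℝ (b j) x) • (WithLp.ofLp ((b j : V') : EuclideanSpace ℝ (Fin r))) = v := by
      have h1 := congrArg (fun y : V' => WithLp.ofLp ((y : V') : EuclideanSpace ℝ (Fin r))) hsum
      simp only [Submodule.coe_sum, Submodule.coe_smul, WithLp.ofLp_sum, WithLp.ofLp_smul] at h1
      rw [h1, hx]
      rfl
    ext i
    rw [← mulVec_mulVec]
    have h2 : (E *ᵥ (Eᴴ *ᵥ v)) i = ∑ j, E i j * (∑ i', E i' j * v i') := by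
      simp only [mulVec, dotProduct, conjTranspose_apply, star_trivial]
    rw [h2]
    have h3 : v i = (∑ j, (inner ℝ (b j) x) • (WithLp.ofLp ((b j : V') : EuclideanSpace ℝ (Fin r)))) i := by rw [hsum']
    rw [h3, Finset.sum_apply]
    -- reindex along `Fin.cast`
    refine Fintype.sum_equiv (finCongr hfin.symm) (fun j => E i j * ∑ i', E i' j * v i')
      (fun c => ((inner ℝ (b c) x) • (WithLp.ofLp ((b c : V') : EuclideanSpace ℝ (Fin r)))) i) fun j => ?_
    simp only [finCongr_apply, Pi.smul_apply, smul_eq_mul]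
    rw [Submodule.coe_inner, EuclideanSpace.inner_eq_star_dotProduct, star_trivial, hx, dotProduct, mul_comm]
    have hLv : WithLp.ofLp (L v) = v := by rw [hL]; rfl
    rw [hLv]
    congr 1
    exact Finset.sum_congr rfl fun i' _ => by rw [hE, mul_comm]

/-- A matrix acting as the identity on `range X` fixes `X` from the left. -/
theorem proj_mul_eq_self {P X : Matrix (Fin r) (Fin r) ℝ} (h : ∀ v ∈ LinearMap.range X.mulVecLin, P *ᵥ v = v) : P * X = X := by
  refine Matrix.ext_iff_mulVec.2 fun v => ?_
  rw [← mulVec_mulVec]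
  exact h _ (LinearMap.mem_range.2 ⟨v, rfl⟩)

/-- … and then also from the right, for symmetric `P` and `X`. -/
theorem mul_proj_eq_self {P X : Matrix (Fin r) (Fin r) ℝ} (hP : Pᴴ = P) (hX : X.IsHermitian) (h : P * X = X) : X * P = X := by
  have h' := congrArg Matrix.conjTranspose h
  rw [conjTranspose_mul, hP, hX.eq] at h'
  exact h'

section Compress

variable {k : ℕ}

/-- `I_k − Eᵀ A E = Eᵀ (I_r − A) E` for an isometry `E`. -/
theorem one_sub_compress (A : Matrix (Fin r) (Fin r) ℝ) {E : Matrix (Fin r) (Fin k) ℝ} (hE : Eᴴ * E = 1) :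
    1 - Eᴴ * A * E = Eᴴ * (1 - A) * E := by
  rw [Matrix.mul_sub, Matrix.sub_mul, Matrix.mul_one, hE]

/-- **Compression by an isometry keeps contractions**: `0 ⪯ A ⪯ I_r`, `Eᵀ E = I_k` ⇒ `0 ⪯ Eᵀ A E ⪯ I_k`.
[cite: BrietDadushPokutta2014, Thm. 6 (§3)] -/
theorem contraction_compress {A : Matrix (Fin r) (Fin r) ℝ} (hA : A.PosSemidef ∧ (1 - A).PosSemidef) {E : Matrix (Fin r) (Fin k) ℝ}
    (hE : Eᴴ * E = 1) : (Eᴴ * A * E).PosSemidef ∧ (1 - Eᴴ * A * E).PosSemidef := by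
  refine ⟨hA.1.conjTranspose_mul_mul_same E, ?_⟩
  rw [one_sub_compress A hE]
  exact hA.2.conjTranspose_mul_mul_same E

/-- The product of two compressions when the left operator is fixed by the projection `E Eᵀ`: `(EᵀXE)(EᵀYE) = Eᵀ(XY)E`. -/
theorem compress_mul_compress {X Y : Matrix (Fin r) (Fin r) ℝ} {E : Matrix (Fin r) (Fin k) ℝ} (hXP : X * (E * Eᴴ) = X) :
    Eᴴ * X * E * (Eᴴ * Y * E) = Eᴴ * (X * Y) * E := by
  calc Eᴴ * X * E * (Eᴴ * Y * E) = Eᴴ * (X * (E * Eᴴ)) * Y * E := by simp only [Matrix.mul_assoc]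
    _ = Eᴴ * (X * Y) * E := by rw [hXP]; simp only [Matrix.mul_assoc]

/-- … and its trace is `tr(X Y)` when moreover `E Eᵀ X = X` (cyclicity). -/
theorem trace_compress_mul_compress {X Y : Matrix (Fin r) (Fin r) ℝ} {E : Matrix (Fin r) (Fin k) ℝ} (hPX : E * Eᴴ * X = X)
    (hXP : X * (E * Eᴴ) = X) : (Eᴴ * X * E * (Eᴴ * Y * E)).trace = (X * Y).trace := by
  rw [compress_mul_compress hXP, trace_mul_comm]
  have h : E * (Eᴴ * (X * Y)) = (E * Eᴴ * X) * Y := by simp only [Matrix.mul_assoc]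
  rw [h, hPX]

end Compress

/-! ### §2 The reduction: a saturated dense tight psd cell is a lower-dimensional tight psd rectangle plus junk -/

/-- **GENERAL SATURATED REDUCTION.** Let `(X, Y)` be a tight-orthogonal psd rectangle of dimension `r ≥ 1` supported on the `t`-cuts,
`W = levelWeight n t C w` with `Σ|w_c| ≤ B_v`, whose ACTIVE tight pairs are SATURATED (`cc(U,M) = 1`, `X_U ≠ 0`, `Y_M ≠ 0 ⇒ rank X_U + rank Y_M = r`).
Assume (SNT-q)-existence for the trace weight `tr Y/r` (hypothesis `hSNT`, the shape of bricks 59/61/72) and cut trace mass `Σ tr X_U / r ≥ 3ε·#t-cuts`.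
Then there are `k < r` and a tight-orthogonal psd rectangle `(X', Y')` of dimension `k`, supported on the `t`-cuts, with
`Σ W·tr(X_U Y_M) ≤ Σ W·tr(X'_U Y'_M) + 2·B_v·ε·r` — namely the compression `X'_U = Eᵀ X_U E` (on the giant class `range X_U = V*`), `Y'_M = Eᵀ Y_M E`
along an isometry `E : ℝ^k → V*`. [cite: Rothvoss2017, §2 (PDF p. 6)] [cite: BrietDadushPokutta2014, Thm. 6 (§3)] [cite: KupavskiiZakharov2022, §2] -/
theorem saturated_reduction {t : ℕ} (hr : 0 < r) (hne : (univ.filter fun U : OddSet n => U.1.card = t).Nonempty)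
    (C : Finset ℕ) (w : ℕ → ℝ) {Bv ε : ℝ} (hBv : ∑ c ∈ C, |w c| ≤ Bv) (hε : 0 < ε)
    {X : OddSet n → Matrix (Fin r) (Fin r) ℝ} {Y : PMatch n → Matrix (Fin r) (Fin r) ℝ} (hXY : IsPsdRect X Y)
    (hXt : ∀ U, U.1.card ≠ t → X U = 0)
    (hsat : ∀ U M, cc U M = 1 → X U ≠ 0 → Y M ≠ 0 → (X U).rank + (Y M).rank = r)
    (hSNT : ∀ (x' : OddSet n → ℝ) (z' : PMatch n → ℝ), (∀ U, 0 ≤ x' U ∧ x' U ≤ 1) → (∀ U, U.1.card ≠ t → x' U = 0) →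
      ε * ((univ.filter fun U : OddSet n => U.1.card = t).card : ℝ) ≤ ∑ U, x' U →
      (∀ M, 0 ≤ z' M ∧ z' M ≤ (Y M).trace / r) → (∑ M, (Y M).trace / r) ≤ 2 * ∑ M, z' M →
      ∃ U M, cc U M = 1 ∧ 0 < x' U ∧ 0 < z' M)
    (hdens : 3 * (ε * ((univ.filter fun U : OddSet n => U.1.card = t).card : ℝ)) ≤ ∑ U, (X U).trace / r) :
    ∃ k : ℕ, k < r ∧ ∃ (X' : OddSet n → Matrix (Fin k) (Fin k) ℝ) (Y' : PMatch n → Matrix (Fin k) (Fin k) ℝ),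
      IsPsdRect X' Y' ∧ (∀ U, U.1.card ≠ t → X' U = 0) ∧
      ∑ U, ∑ M, levelWeight n t C w U M * (X U * Y M).trace ≤
        ∑ U, ∑ M, levelWeight n t C w U M * (X' U * Y' M).trace + 2 * Bv * ε * r := by
  classical
  set Nt : ℝ := ((univ.filter fun U : OddSet n => U.1.card = t).card : ℝ) with hNt
  have hr' : (0 : ℝ) < r := by exact_mod_cast hr
  have hNpos : 0 < Nt := by rw [hNt]; exact_mod_cast card_pos.2 hne
  -- labels: ranges of the cut operators, kernels of the matching operators
  set κ : OddSet n → Submodule ℝ (Fin r → ℝ) := fun U => LinearMap.range (X U).mulVecLin with hκ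
  set lam : PMatch n → Submodule ℝ (Fin r → ℝ) := fun M => LinearMap.ker (Y M).mulVecLin with hlam
  have hclosed : ∀ U M, cc U M = 1 → X U ≠ 0 → Y M ≠ 0 → κ U = lam M := fun U M hcc hXU hYM =>
    range_eq_ker_of_saturated (hXY.1 U).1.1 (hXY.2.1 M).1.1 (hXY.2.2 U M hcc) (hsat U M hcc hXU hYM)
  have hdens2 : 2 * (ε * Nt) ≤ ∑ U, (X U).trace / r := by nlinarith [mul_pos hε hNpos]
  obtain ⟨V, hoff, hval⟩ := value_le_giant_class_add hr hne C w hBv hε hXY hXt κ lam hclosed hSNT hdens2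
  -- the giant label is a PROPER subspace: a cut of full-rank `X_U` has no active tight partner
  have hVtop : V ≠ ⊤ := by
    intro hV
    set x' : OddSet n → ℝ := fun U => if κ U = V then (X U).trace / r else 0 with hx'
    have hx'01 : ∀ U, 0 ≤ x' U ∧ x' U ≤ 1 := fun U => by
      rw [hx']; dsimp only
      split_ifs
      · refine ⟨div_nonneg (hXY.1 U).1.trace_nonneg hr'.le, ?_⟩
        rw [div_le_one hr']
        have h := (hXY.1 U).2.trace_nonneg
        rw [trace_sub, trace_one, Fintype.card_fin] at h
        linarith
      · exact ⟨le_rfl, zero_le_one⟩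
    have hx't : ∀ U, U.1.card ≠ t → x' U = 0 := fun U hU => by
      rw [hx']; dsimp only; rw [hXt U hU, trace_zero, zero_div, ite_self]
    have hx'sum : ε * Nt ≤ ∑ U, x' U := by
      have hsplit := sum_filter_add_sum_filter_not (univ : Finset (OddSet n)) (fun U => κ U = V) (fun U => (X U).trace / r)
      have h1 : ∑ U, x' U = ∑ U ∈ univ.filter (fun U => κ U = V), (X U).trace / r := by rw [hx', ← sum_filter]
      have h2 : ∑ U ∈ univ.filter (fun U => ¬κ U = V), (X U).trace / r ≤ 2 * (ε * Nt) := by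
        have h3 : ∑ U ∈ univ.filter (fun U => ¬κ U = V), (X U).trace / r =
            (∑ U ∈ univ.filter (fun U => κ U ≠ V), (X U).trace) / r := by
          rw [sum_div]
        rw [h3, div_le_iff₀ hr']
        calc ∑ U ∈ univ.filter (fun U => κ U ≠ V), (X U).trace ≤ 2 * ε * r * Nt := hoff
          _ = 2 * (ε * Nt) * r := by ring
      rw [h1]
      linarith
    have hz : ∀ M, 0 ≤ (Y M).trace / r ∧ (Y M).trace / r ≤ (Y M).trace / r := fun M =>
      ⟨div_nonneg (hXY.2.1 M).1.trace_nonneg hr'.le, le_rfl⟩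
    have hzsum : (∑ M, (Y M).trace / r) ≤ 2 * ∑ M, (Y M).trace / r := by
      have : 0 ≤ ∑ M, (Y M).trace / r := sum_nonneg fun M _ => (hz M).1
      linarith
    obtain ⟨U, M, hcc, hxU, hzM⟩ := hSNT x' _ hx'01 hx't hx'sum hz hzsum
    have hUV : κ U = V := by
      by_contra h; rw [hx'] at hxU; dsimp only at hxU; rw [if_neg h] at hxU; exact lt_irrefl _ hxU
    have hXU : X U ≠ 0 := by
      intro h0; rw [hx'] at hxU; dsimp only at hxU; rw [if_pos hUV, h0, trace_zero, zero_div] at hxU; exact lt_irrefl _ hxU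
    have hYM : Y M ≠ 0 := by
      intro h0; rw [h0, trace_zero, zero_div] at hzM; exact lt_irrefl _ hzM
    have hker : lam M = ⊤ := by rw [← hclosed U M hcc hXU hYM, hUV, hV]
    apply hYM
    refine Matrix.ext_iff_mulVec.2 fun v => ?_
    have hv : v ∈ lam M := by rw [hker]; exact Submodule.mem_top
    rw [hlam] at hv; dsimp only at hv
    rw [LinearMap.mem_ker, Matrix.mulVecLin_apply] at hv
    rw [hv, zero_mulVec]
  -- compress along an isometry onto `V`
  set k := Module.finrank ℝ V with hk
  have hkr : k < r := by
    have h := Submodule.finrank_lt hVtop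
    rw [Module.finrank_fin_fun] at h
    exact h
  obtain ⟨E, hEE, hEfix⟩ := exists_isometry_of_submodule V
  have hP : (E * Eᴴ)ᴴ = E * Eᴴ := by rw [conjTranspose_mul, conjTranspose_conjTranspose]
  have hPX : ∀ U, κ U = V → E * Eᴴ * X U = X U := fun U hU =>
    proj_mul_eq_self fun v hv => hEfix v (by rw [← hU]; exact hv)
  have hXP : ∀ U, κ U = V → X U * (E * Eᴴ) = X U := fun U hU => mul_proj_eq_self hP (hXY.1 U).1.1 (hPX U hU)
  set X' : OddSet n → Matrix (Fin k) (Fin k) ℝ := fun U => if κ U = V then Eᴴ * X U * E else 0 with hX'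
  set Y' : PMatch n → Matrix (Fin k) (Fin k) ℝ := fun M => Eᴴ * Y M * E with hY'
  refine ⟨k, hkr, X', Y', ⟨fun U => ?_, fun M => contraction_compress (hXY.2.1 M) hEE, fun U M hcc => ?_⟩, fun U hU => ?_, ?_⟩
  · rw [hX']; dsimp only
    split_ifs
    · exact contraction_compress (hXY.1 U) hEE
    · rw [sub_zero]; exact ⟨PosSemidef.zero, PosSemidef.one⟩
  · show X' U * Y' M = 0
    rw [hX', hY']; dsimp only
    split_ifs with hU
    · rw [compress_mul_compress (hXP U hU), hXY.2.2 U M hcc, Matrix.mul_zero, Matrix.zero_mul]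
    · rw [Matrix.zero_mul]
  · rw [hX']; dsimp only; rw [hXt U hU, Matrix.mul_zero, Matrix.zero_mul, ite_self]
  · -- the compressed value is the value of the giant class
    have hvalue : ∑ U, ∑ M, levelWeight n t C w U M * (X' U * Y' M).trace =
        ∑ U ∈ univ.filter (fun U => κ U = V), ∑ M, levelWeight n t C w U M * (X U * Y M).trace := by
      rw [← sum_filter_add_sum_filter_not univ (fun U => κ U = V)]
      have hz : ∑ U ∈ univ.filter (fun U => ¬κ U = V), ∑ M, levelWeight n t C w U M * (X' U * Y' M).trace = 0 :=
        sum_eq_zero fun U hU => sum_eq_zero fun M _ => by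
          have hU' : ¬κ U = V := (mem_filter.1 hU).2
          rw [hX']; dsimp only; rw [if_neg hU', Matrix.zero_mul, trace_zero, mul_zero]
      rw [hz, add_zero]
      refine sum_congr rfl fun U hU => sum_congr rfl fun M _ => ?_
      have hU' : κ U = V := (mem_filter.1 hU).2
      rw [hX', hY']; dsimp only; rw [if_pos hU', trace_compress_mul_compress (hPX U hU') (hXP U hU')]
    rw [hvalue]
    exact hval

/-- **SATURATED DENSE CELLS REDUCE TO LOWER DIMENSION.** In the setting of `saturated_reduction`, if the design weight has tracial value
`≤ γ_k` on tight-orthogonal psd rectangles of every dimension `k < r` (`TracialValueLEAt W γ_k k`), then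
`Σ W·tr(X_U Y_M) ≤ k·γ_k + 2·B_v·ε·r` for some `k < r`. (With the `r = 1` rung this is bricks 61/73 at `r = 2`; with the unconditional
bounded-dimension theorem it bounds every saturated cell at fixed `r`; the open residual at every `r` is the UNSATURATED cell.)
[cite: Rothvoss2017, §2 (PDF p. 6)] [cite: BrietDadushPokutta2014, Thm. 6 (§3)] [cite: KupavskiiZakharov2022, §2] -/
theorem saturated_value_le {t : ℕ} (hr : 0 < r) (hne : (univ.filter fun U : OddSet n => U.1.card = t).Nonempty)
    (C : Finset ℕ) (w : ℕ → ℝ) {Bv ε : ℝ} (hBv : ∑ c ∈ C, |w c| ≤ Bv) (hε : 0 < ε)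
    {X : OddSet n → Matrix (Fin r) (Fin r) ℝ} {Y : PMatch n → Matrix (Fin r) (Fin r) ℝ} (hXY : IsPsdRect X Y)
    (hXt : ∀ U, U.1.card ≠ t → X U = 0)
    (hsat : ∀ U M, cc U M = 1 → X U ≠ 0 → Y M ≠ 0 → (X U).rank + (Y M).rank = r)
    (hSNT : ∀ (x' : OddSet n → ℝ) (z' : PMatch n → ℝ), (∀ U, 0 ≤ x' U ∧ x' U ≤ 1) → (∀ U, U.1.card ≠ t → x' U = 0) →
      ε * ((univ.filter fun U : OddSet n => U.1.card = t).card : ℝ) ≤ ∑ U, x' U →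
      (∀ M, 0 ≤ z' M ∧ z' M ≤ (Y M).trace / r) → (∑ M, (Y M).trace / r) ≤ 2 * ∑ M, z' M →
      ∃ U M, cc U M = 1 ∧ 0 < x' U ∧ 0 < z' M)
    (hdens : 3 * (ε * ((univ.filter fun U : OddSet n => U.1.card = t).card : ℝ)) ≤ ∑ U, (X U).trace / r)
    (γ : ℕ → ℝ) (hγ : ∀ k, k < r → TracialValueLEAt (levelWeight n t C w) (γ k) k) :
    ∃ k : ℕ, k < r ∧ ∑ U, ∑ M, levelWeight n t C w U M * (X U * Y M).trace ≤ k * γ k + 2 * Bv * ε * r := by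
  obtain ⟨k, hkr, X', Y', hXY', -, hle⟩ := saturated_reduction hr hne C w hBv hε hXY hXt hsat hSNT hdens
  refine ⟨k, hkr, ?_⟩
  have h := hγ k hkr X' Y' hXY'
  suffices hk : ∑ U, ∑ M, levelWeight n t C w U M * (X' U * Y' M).trace ≤ k * γ k by linarith
  rcases Nat.eq_zero_or_pos k with hk0 | hkpos
  · -- dimension `0`: every trace vanishes
    subst hk0
    have hz : ∑ U, ∑ M, levelWeight n t C w U M * (X' U * Y' M).trace = 0 :=
      sum_eq_zero fun U _ => sum_eq_zero fun M _ => by rw [Matrix.trace, Fintype.sum_empty, mul_zero]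
    rw [hz]; simp
  · have hk' : (0 : ℝ) < k := by exact_mod_cast hkpos
    rw [div_le_iff₀ hk'] at h
    linarith

end Summit.PneNP.PneNP.Theorems.ChebyshevTracialDesignSaturatedReduction

end
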